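import Summits.SmoothPoincare4.SmoothPoincare4.Theorems.EntropyRungNoncompactShrinkerGapHeatCutoffToolkit
import HarnessLib

/-!
# Conservation of mass for the weighted heat flow on a complete manifold (crux
# `EntropyRung.NoncompactShrinkerGap`, stmt-SmoothPoincare4-10868, line `collapsed-ends-usc`, v13;
# registered helper `helper_massConservation`)

Setting: `(M, g)` Riemannian, modelled on `ℝⁿ` (Hausdorff, second countable, NOT compact), `V`
smooth with `e^{-V}` integrable, `L = Δ_g − g⁻¹(dV, d·)`; cut-offs `η_k ∈ C_c^∞`, `0 ≤ η_k ≤ 1`,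
eventually `= 1` near every point, `|Lη_k| ≤ C`; `ρ` smooth on `M × O`, `O ⊇ [0, T]` open,
`∂ₛρ = Lρ` on `[0, T]`, `|ρ| ≤ B` there. Then `∫ ρ(s) e^{-V} = ∫ ρ(0) e^{-V}` for `s ∈ [0, T]`.

Proof (`abs_integral_cutoff_sub_le`, `helper_massConservation`): with
`F_k(s) = ∫ ρ(s) η_k e^{-V}`, the Leibniz rule against the compactly supported weight `η_k e^{-V}`
and `∫ η_k (Lρ) e^{-V} = ∫ ρ (Lη_k) e^{-V}` (`CutoffToolkit.integral_cutoff_mul_weightedLaplacian`)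
give `|F_k'| ≤ B ∫ |Lη_k| e^{-V}`, hence `|F_k(s) − F_k(0)| ≤ s B ∫ |Lη_k| e^{-V} → 0` (dominated
convergence: `|Lη_k| ≤ C`, `Lη_k → 0` pointwise, `e^{-V} ∈ L¹`), while `F_k(s) → ∫ ρ(s) e^{-V}`
(dominated by `B e^{-V}`). Closed-manifold model: `heatFlow_integral_eq`
(`WeightedHeatFlowAPriori.lean`). Source: J. A. Carrillo, L. Ni, Comm. Anal. Geom. 17 (2009),
§3 (3.1)–(3.2) and §4 (cut-off integrations by parts) [CarrilloNi2009].
-/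

noncomputable section

set_option linter.dupNamespace false

open scoped Manifold ContDiff ENNReal NNReal Topology
open MeasureTheory Set Filter
open Literature.Geometry.Lorentzian Literature.Geometry.Riemannian

namespace Summit.SmoothPoincare4.SmoothPoincare4.Theorems.NoncompactShrinkerGapHeat

open CutoffToolkit

section Mass

variable {n : ℕ} {M : Type*} [TopologicalSpace M] [T2Space M] [SecondCountableTopology M]
  [ChartedSpace (EuclideanSpace ℝ (Fin n)) M] [IsManifold (𝓡 n) ∞ M] [T3Space M]
  [MeasurableSpace M] [BorelSpace M]
  {g : PseudoRiemannianMetric (𝓡 n) ∞ (EuclideanSpace ℝ (Fin n)) (TangentSpace (𝓡 n) : M → Type _)}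
  [g.HasLeviCivita]

/-- **Cut-off mass is almost conserved**: for `V` smooth, `η ∈ C_c^∞`, `ρ` smooth on `M × O`
(`O ⊇ [0, T]` open) with `∂ₛρ = Lρ` and `|ρ| ≤ B` on `[0, T]`, and `|Lη| e^{-V}` integrable,
`|∫ ρ(s) η e^{-V} − ∫ ρ(0) η e^{-V}| ≤ (B ∫ |Lη| e^{-V}) s` for `s ∈ [0, T]`: the derivative of
`s ↦ ∫ ρ(s) η e^{-V}` is `∫ (Lρ) η e^{-V} = ∫ ρ (Lη) e^{-V}` (Leibniz rule,
`integral_cutoff_mul_weightedLaplacian`), bounded by `B ∫ |Lη| e^{-V}`; mean value inequality.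
[cite: CarrilloNi2009, §3 (3.1)–(3.2)] -/
theorem abs_integral_cutoff_sub_le (hg : g.IsRiemannian) {V : M → ℝ}
    (hV : ContMDiff (𝓡 n) 𝓘(ℝ, ℝ) ∞ V) {η : M → ℝ} (hη : ContMDiff (𝓡 n) 𝓘(ℝ, ℝ) ∞ η)
    (hηc : HasCompactSupport η) {T : ℝ} {O : Set ℝ} {ρ : ℝ → M → ℝ} (hO : IsOpen O)
    (hTO : Icc 0 T ⊆ O)
    (hρ : ContMDiffOn ((𝓡 n).prod 𝓘(ℝ, ℝ)) 𝓘(ℝ, ℝ) ∞ (fun p : M × ℝ ↦ ρ p.2 p.1) (univ ×ˢ O))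
    (heq : ∀ s ∈ Icc 0 T, ∀ x, deriv (fun r ↦ ρ r x) s = g.dalembertian (ρ s) x
      - g.innerDual x (mvfderiv (𝓡 n) V x).toLinearMap (mvfderiv (𝓡 n) (ρ s) x).toLinearMap)
    {B : ℝ} (hB : ∀ s ∈ Icc 0 T, ∀ x, |ρ s x| ≤ B)
    (hLi : Integrable (fun x ↦ |g.dalembertian η x - g.innerDual x (mvfderiv (𝓡 n) V x).toLinearMap
      (mvfderiv (𝓡 n) η x).toLinearMap| * Real.exp (-V x)) g.riemVolume)
    {s : ℝ} (hs : s ∈ Icc 0 T) :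
    |(∫ x, ρ s x * (η x * Real.exp (-V x)) ∂g.riemVolume)
        - ∫ x, ρ 0 x * (η x * Real.exp (-V x)) ∂g.riemVolume| ≤
      (B * ∫ x, |g.dalembertian η x - g.innerDual x (mvfderiv (𝓡 n) V x).toLinearMap
        (mvfderiv (𝓡 n) η x).toLinearMap| * Real.exp (-V x) ∂g.riemVolume) * s := by
  haveI := CarrilloNi2009_shrinkerLSI.isFiniteMeasureOnCompacts_riemVolume hg
  set μ : Measure M := g.riemVolume with hμ
  set Lη : M → ℝ := fun x ↦ g.dalembertian η x
    - g.innerDual x (mvfderiv (𝓡 n) V x).toLinearMap (mvfderiv (𝓡 n) η x).toLinearMap with hLη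
  have hec : Continuous fun x ↦ Real.exp (-V x) := Real.continuous_exp.comp hV.continuous.neg
  have hw : Continuous fun x ↦ η x * Real.exp (-V x) := hη.continuous.mul hec
  have hwc : HasCompactSupport fun x ↦ η x * Real.exp (-V x) := hηc.mul_right
  have hslice : ∀ r ∈ O, ContMDiff (𝓡 n) 𝓘(ℝ, ℝ) ∞ (ρ r) := fun r hr ↦
    contMDiff_slice_of_contMDiffOn hρ hr
  have hρc : ContinuousOn (fun p : M × ℝ ↦ ρ p.2 p.1) (univ ×ˢ O) := hρ.continuousOn
  have hρ'c : ContinuousOn (fun p : M × ℝ ↦ deriv (fun r ↦ ρ r p.1) p.2) (univ ×ˢ O) :=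
    continuousOn_deriv_time hO hρ
  -- the cut-off mass and its derivative
  set Fk : ℝ → ℝ := fun r ↦ ∫ x, ρ r x * (η x * Real.exp (-V x)) ∂μ with hFk
  set Dk : ℝ → ℝ := fun r ↦ ∫ x, deriv (fun r' ↦ ρ r' x) r * (η x * Real.exp (-V x)) ∂μ with hDk
  have hderiv : ∀ r ∈ O, HasDerivAt Fk (Dk r) r := fun r hr ↦
    hasDerivAt_integral_mul_of_hasCompactSupport μ hw hwc hO hρc hρ'c
      (fun r hr x ↦ hasDerivAt_time hO hρ x hr) hr
  -- on `[0, T]` the derivative is `∫ ρ (Lη) e^{-V}`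
  have hDk : ∀ r ∈ Icc 0 T, Dk r = ∫ x, ρ r x * Lη x * Real.exp (-V x) ∂μ := by
    intro r hr
    have e1 : Dk r = ∫ x, η x * (g.dalembertian (ρ r) x - g.innerDual x
        (mvfderiv (𝓡 n) V x).toLinearMap (mvfderiv (𝓡 n) (ρ r) x).toLinearMap) *
          Real.exp (-V x) ∂μ := by
      refine integral_congr_ae (Eventually.of_forall fun x ↦ ?_)
      simp only [heq r hr x]
      ring
    rw [e1, integral_cutoff_mul_weightedLaplacian hg (hslice r (hTO hr)) hη hηc hV]
  -- and it is bounded by `B ∫ |Lη| e^{-V}`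
  have hbound : ∀ r ∈ Ico (0 : ℝ) T, ‖Dk r‖ ≤ B * ∫ x, |Lη x| * Real.exp (-V x) ∂μ := by
    intro r hr
    have hr' : r ∈ Icc 0 T := Ico_subset_Icc_self hr
    rw [hDk r hr', Real.norm_eq_abs]
    calc |∫ x, ρ r x * Lη x * Real.exp (-V x) ∂μ|
        ≤ ∫ x, |ρ r x * Lη x * Real.exp (-V x)| ∂μ := abs_integral_le_integral_abs
      _ ≤ ∫ x, B * (|Lη x| * Real.exp (-V x)) ∂μ := by
          refine integral_mono_of_nonneg (Eventually.of_forall fun x ↦ abs_nonneg _)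
            (hLi.const_mul B) (Eventually.of_forall fun x ↦ ?_)
          show |ρ r x * Lη x * Real.exp (-V x)| ≤ B * (|Lη x| * Real.exp (-V x))
          rw [abs_mul, abs_mul, abs_of_nonneg (Real.exp_nonneg _)]
          calc |ρ r x| * |Lη x| * Real.exp (-V x) = |ρ r x| * (|Lη x| * Real.exp (-V x)) := by ring
            _ ≤ B * (|Lη x| * Real.exp (-V x)) :=
              mul_le_mul_of_nonneg_right (hB r hr' x)
                (mul_nonneg (abs_nonneg _) (Real.exp_nonneg _))
      _ = B * ∫ x, |Lη x| * Real.exp (-V x) ∂μ := integral_const_mul _ _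
  -- mean value inequality on `[0, s] ⊆ [0, T]`
  have hmv := norm_image_sub_le_of_norm_deriv_le_segment' (f := Fk)
    (fun r hr ↦ (hderiv r (hTO hr)).hasDerivWithinAt) hbound s hs
  rw [sub_zero, Real.norm_eq_abs] at hmv
  exact hmv

/-- **Conservation of mass for the weighted heat flow on a complete manifold** (registered helper
`helper_massConservation` of the crux `EntropyRung.NoncompactShrinkerGap`): with `e^{-V} ∈ L¹`,
cut-offs `η_k ∈ C_c^∞`, `0 ≤ η_k ≤ 1`, eventually `1` near every point, `|Lη_k| ≤ C`, and a
bounded solution `ρ` of `∂ₛρ = Lρ` on `[0, T]`, `∫ ρ(s) e^{-V} dV = ∫ ρ(0) e^{-V} dV` for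
`s ∈ [0, T]`: `abs_integral_cutoff_sub_le` with `η = η_k`, `∫ |Lη_k| e^{-V} → 0` and
`∫ ρ(s) η_k e^{-V} → ∫ ρ(s) e^{-V}` by dominated convergence. [cite: CarrilloNi2009, §3 (3.1)–(3.2)] -/
theorem helper_massConservation : ∀ (n : ℕ) (M : Type*) [TopologicalSpace M] [T2Space M] [SecondCountableTopology M] [ChartedSpace (EuclideanSpace ℝ (Fin n)) M] [IsManifold (𝓡 n) ∞ M] [T3Space M] [MeasurableSpace M] [BorelSpace M] (g : PseudoRiemannianMetric (𝓡 n) ∞ (EuclideanSpace ℝ (Fin n)) (TangentSpace (𝓡 n) : M → Type _)) [g.HasLeviCivita] (V : M → ℝ), g.IsRiemannian → ContMDiff (𝓡 n) 𝓘(ℝ, ℝ) ∞ V → Integrable (fun x ↦ Real.exp (-V x)) g.riemVolume → ∀ (η : ℕ → M → ℝ) (C : ℝ), (∀ k, ContMDiff (𝓡 n) 𝓘(ℝ, ℝ) ∞ (η k)) → (∀ k, HasCompactSupport (η k)) → (∀ k x, 0 ≤ η k x ∧ η k x ≤ 1) → (∀ k x, η k x ≤ η (k + 1) x) → (∀ x,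 ∀ᶠ k in atTop, ∀ᶠ y in 𝓝 x, η k y = 1) → (∀ k x, |g.dalembertian (η k) x - g.innerDual x (mvfderiv (𝓡 n) V x).toLinearMap (mvfderiv (𝓡 n) (η k) x).toLinearMap| ≤ C) → ∀ (T : ℝ) (O : Set ℝ) (ρ : ℝ → M → ℝ), 0 < T → IsOpen O → Icc 0 T ⊆ O → ContMDiffOn ((𝓡 n).prod 𝓘(ℝ, ℝ)) 𝓘(ℝ, ℝ) ∞ (fun p : M × ℝ ↦ ρ p.2 p.1) (univ ×ˢ O) → (∀ s ∈ Icc 0 T, ∀ x, deriv (fun r ↦ ρ r x) s = g.dalembertian (ρ s) x - g.innerDual x (mvfderiv (𝓡 n) V x).toLinearMap (mvfderiv (𝓡 n) (ρ s) x).toLinearMap) → ∀ (B : ℝ), (∀ s ∈ Icc 0 T, ∀ x, |ρ s x| ≤ B) → ∀ s ∈ Icc 0 T, ∫ x, ρ s x * Real.exp (-V x) ∂g.riemVolume = ∫ x, ρ 0 x * Real.exp (-V x) ∂g.riemVolume := by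
  intro n M _ _ _ _ _ _ _ _ g _ V hg hV hVint η C hηs hηc hη01 _hmono hη1 hLη T O ρ hT hO hTO hρ heq
    B hB s hs
  haveI := CarrilloNi2009_shrinkerLSI.isFiniteMeasureOnCompacts_riemVolume hg
  have h1 : (1 : ℕ∞ω) ≤ (∞ : ℕ∞ω) := WithTop.coe_le_coe.mpr le_top
  have h2 : (2 : ℕ∞ω) ≤ (∞ : ℕ∞ω) := WithTop.coe_le_coe.mpr le_top
  set μ : Measure M := g.riemVolume with hμ
  set L : ℕ → M → ℝ := fun k x ↦ g.dalembertian (η k) x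
    - g.innerDual x (mvfderiv (𝓡 n) V x).toLinearMap (mvfderiv (𝓡 n) (η k) x).toLinearMap with hL
  have hec : Continuous fun x ↦ Real.exp (-V x) := Real.continuous_exp.comp hV.continuous.neg
  have hLc : ∀ k, Continuous (L k) := fun k ↦
    (continuous_dalembertian g ((hηs k).of_le h2)).sub
      (continuous_innerDual_mvfderiv g (hV.of_le h1) ((hηs k).of_le h1))
  have hslice : ∀ r ∈ O, ContMDiff (𝓡 n) 𝓘(ℝ, ℝ) ∞ (ρ r) := fun r hr ↦
    contMDiff_slice_of_contMDiffOn hρ hr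
  have h0T : (0 : ℝ) ∈ Icc 0 T := ⟨le_rfl, hT.le⟩
  -- `|Lη_k| e^{-V}` is dominated by `C e^{-V}` and tends to `0`
  have hLbd : ∀ k x, ‖|L k x| * Real.exp (-V x)‖ ≤ C * Real.exp (-V x) := fun k x ↦ by
    rw [Real.norm_eq_abs, abs_mul, abs_abs, abs_of_nonneg (Real.exp_nonneg _)]
    exact mul_le_mul_of_nonneg_right (hLη k x) (Real.exp_nonneg _)
  have hLm : ∀ k, AEStronglyMeasurable (fun x ↦ |L k x| * Real.exp (-V x)) μ := fun k ↦
    ((continuous_abs.comp (hLc k)).mul hec).aestronglyMeasurable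
  have hLi : ∀ k, Integrable (fun x ↦ |L k x| * Real.exp (-V x)) μ := fun k ↦
    (hVint.const_mul C).mono' (hLm k) (Eventually.of_forall (hLbd k))
  have hLt : Tendsto (fun k ↦ ∫ x, |L k x| * Real.exp (-V x) ∂μ) atTop (𝓝 0) := by
    have hlim : ∀ x, Tendsto (fun k ↦ |L k x| * Real.exp (-V x)) atTop (𝓝 0) := fun x ↦ by
      refine tendsto_const_nhds.congr' ?_
      filter_upwards [weightedLaplacian_cutoff_eventually_eq_zero (g := g) (V := V) hη1 x] with k hk
      rw [show L k x = 0 from hk, abs_zero, zero_mul]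
    have h := tendsto_integral_of_dominated_convergence (fun x ↦ C * Real.exp (-V x)) hLm
      (hVint.const_mul C) (fun k ↦ Eventually.of_forall (hLbd k)) (Eventually.of_forall hlim)
    simpa using h
  -- Step 1: `|F_k(s) - F_k(0)| ≤ (B ∫ |Lη_k| e^{-V}) s`
  have hstep : ∀ k, |(∫ x, ρ s x * (η k x * Real.exp (-V x)) ∂μ)
      - ∫ x, ρ 0 x * (η k x * Real.exp (-V x)) ∂μ| ≤
        (B * ∫ x, |L k x| * Real.exp (-V x) ∂μ) * s := fun k ↦
    abs_integral_cutoff_sub_le hg hV (hηs k) (hηc k) hO hTO hρ heq hB (hLi k) hs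
  -- Step 2: `F_k(r) → ∫ ρ(r) e^{-V}` for `r ∈ [0, T]`
  have hconv : ∀ r ∈ Icc 0 T, Tendsto (fun k ↦ ∫ x, ρ r x * (η k x * Real.exp (-V x)) ∂μ) atTop
      (𝓝 (∫ x, ρ r x * Real.exp (-V x) ∂μ)) := by
    intro r hr
    refine tendsto_integral_of_dominated_convergence (fun x ↦ B * Real.exp (-V x))
      (fun k ↦ ((hslice r (hTO hr)).continuous.mul ((hηs k).continuous.mul hec)).aestronglyMeasurable)
      (hVint.const_mul B) (fun k ↦ Eventually.of_forall fun x ↦ ?_) (Eventually.of_forall fun x ↦ ?_)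
    · rw [Real.norm_eq_abs, abs_mul, abs_mul, abs_of_nonneg (hη01 k x).1,
        abs_of_nonneg (Real.exp_nonneg _)]
      calc |ρ r x| * (η k x * Real.exp (-V x)) ≤ |ρ r x| * Real.exp (-V x) :=
            mul_le_mul_of_nonneg_left (mul_le_of_le_one_left (Real.exp_nonneg _) (hη01 k x).2)
              (abs_nonneg _)
        _ ≤ B * Real.exp (-V x) := mul_le_mul_of_nonneg_right (hB r hr x) (Real.exp_nonneg _)
    · simpa using ((tendsto_cutoff hη1 x).mul_const (Real.exp (-V x))).const_mul (ρ r x)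
  -- Step 3: the limit of `F_k(s) - F_k(0)` is both `∫ ρ(s) e^{-V} - ∫ ρ(0) e^{-V}` and `0`
  have ha : Tendsto (fun k ↦ (∫ x, ρ s x * (η k x * Real.exp (-V x)) ∂μ)
      - ∫ x, ρ 0 x * (η k x * Real.exp (-V x)) ∂μ) atTop
      (𝓝 ((∫ x, ρ s x * Real.exp (-V x) ∂μ) - ∫ x, ρ 0 x * Real.exp (-V x) ∂μ)) :=
    (hconv s hs).sub (hconv 0 h0T)
  have ha0 : Tendsto (fun k ↦ (∫ x, ρ s x * (η k x * Real.exp (-V x)) ∂μ)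
      - ∫ x, ρ 0 x * (η k x * Real.exp (-V x)) ∂μ) atTop (𝓝 0) := by
    refine squeeze_zero_norm (a := fun k ↦ (B * ∫ x, |L k x| * Real.exp (-V x) ∂μ) * s)
      (fun k ↦ ?_) ?_
    · rw [Real.norm_eq_abs]
      exact hstep k
    · simpa using (hLt.const_mul B).mul_const s
  exact sub_eq_zero.mp (tendsto_nhds_unique ha ha0)

end Mass

end Summit.SmoothPoincare4.SmoothPoincare4.Theorems.NoncompactShrinkerGapHeat

end
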